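import Summits.Ventures.PercRepro.RankLevelSetDepCount
import Summits.Ventures.PercRepro.RankLevelSetConfinement
import Summits.Ventures.PercRepro.RankLevelSetSubsetsMeeting

/-!
# PercRepro — `#U` counted by its rank-`q` sets WITH their coindependence kept (p8 g12, S3)

night-1's `topCount_le_ncard_compl` maps `A ∈ U` to `B = E ∖ A` and forgets that `E ∖ B = A` spans. Keeping it
(`topCount_le_ncard_compl_spanning`) is the first step of the recipe of `proofs/P8-G12-LEVER22.md` §6: the class of the
independent `6`-sets of the cell then consists of coindependent sets only, and with two distinct triangles every such set
meets `C₁ ∪ C₂` (`indep_six_coindep_subset_meeting`, on THE CONFINEMENT LEMMA), so at corank `7` the class numbers at most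
`C(n, 6) − C(n − 6, 6)` (`ncard_indep_six_coindep_le_of_two_triangles`). Axioms: standard.
-/

open scoped Matroid

namespace PercRepro

namespace Matroid

open Set

variable {α : Type} {M : _root_.Matroid α}

/-- `#U(p, q) ≤ #{B ⊆ E : r(B) = q, |B| ≤ d, E ∖ B spans}` — night-1's `topCount_le_ncard_compl` with the
spanning of the complement kept. -/
theorem topCount_le_ncard_compl_spanning [M.Finite] {p d : ℕ} (hR : M.eRank = (p : ℕ∞))
    (hd : M.E.encard = M.eRank + d) (q : ℕ) :
    topCount M p q ≤
      {B : Set α | B ⊆ M.E ∧ M.eRk B = q ∧ B.ncard ≤ d ∧ M.eRk (M.E \ B) = (p : ℕ∞)}.ncard := by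
  classical
  have hν : M✶.eRank = (d : ℕ∞) := by
    have h := _root_.Matroid.eRank_add_eRank_dual M
    rw [hd] at h
    exact WithTop.add_left_cancel (eRank_ne_top_of_finite M) h
  unfold topCount
  have hmaps : ∀ A ∈ {A : Set α | A ⊆ M.E ∧ M.eRk A = (p : ℕ∞) ∧ M.eRk (M.E \ A) = (q : ℕ∞)},
      M.E \ A ∈ {B : Set α | B ⊆ M.E ∧ M.eRk B = q ∧ B.ncard ≤ d ∧ M.eRk (M.E \ B) = (p : ℕ∞)} := by
    intro A hA
    refine ⟨sdiff_subset, hA.2.2, ?_, ?_⟩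
    · have hsp : M.Spanning A := by
        rw [_root_.Matroid.spanning_iff_eRk_le']
        exact ⟨by rw [hR, hA.2.1], hA.1⟩
      have hco : M.Coindep (M.E \ A) := by
        rw [_root_.Matroid.coindep_iff_compl_spanning sdiff_subset, sdiff_sdiff_cancel_left hA.1]
        exact hsp
      have hind : M✶.Indep (M.E \ A) := _root_.Matroid.coindep_def.1 hco
      have h := hind.encard_le_eRank
      rw [hν, ← (M.ground_finite.sdiff).cast_ncard_eq] at h
      exact_mod_cast h
    · rw [sdiff_sdiff_cancel_left hA.1]
      exact hA.2.1
  have hinj : InjOn (fun A => M.E \ A)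
      {A : Set α | A ⊆ M.E ∧ M.eRk A = (p : ℕ∞) ∧ M.eRk (M.E \ A) = (q : ℕ∞)} := by
    intro A hA A' hA' h
    simp only at h
    rw [← sdiff_sdiff_cancel_left hA.1, h, sdiff_sdiff_cancel_left hA'.1]
  exact ncard_le_ncard_of_injOn (fun A => M.E \ A) hmaps hinj
    (M.ground_finite.finite_subsets.subset (fun B hB => hB.1))

/-- With two distinct circuits `C₁ ≠ C₂`, every coindependent set `B` with `|B| ≥ d − 1` meets `C₁ ∪ C₂`:
the coindependent independent `6`-sets at corank `7` lie in the family `{B ⊆ E : |B| = 6, B ∩ (C₁ ∪ C₂) ≠ ∅}`. -/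
theorem indep_six_coindep_subset_meeting [M.Finite] {p d : ℕ} (hn : M.E.ncard = p + d)
    {C₁ C₂ : Set α} (h1 : M.IsCircuit C₁) (h2 : M.IsCircuit C₂) (hne : C₁ ≠ C₂) (hd : d ≤ 7) :
    {B : Set α | B ⊆ M.E ∧ B.ncard = 6 ∧ M.eRk (M.E \ B) = (p : ℕ∞)} ⊆
      {B : Set α | B ⊆ (M.ground_finite.toFinset : Set α) ∧ B.ncard = 6 ∧ (B ∩ (C₁ ∪ C₂)).Nonempty} := by
  rintro B ⟨hBE, hB6, hspan⟩
  refine ⟨?_, hB6, ?_⟩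
  · rw [Set.Finite.coe_toFinset]
    exact hBE
  · have key := ThmN.inter_union_nonempty_of_spanning_of_two_circuits M (A := M.E \ B) sdiff_subset h1 h2 hne
      hn hspan (by rw [sdiff_sdiff_cancel_left hBE]; omega)
    rwa [sdiff_sdiff_cancel_left hBE] at key

/-- **The coindependent independent `6`-sets at corank `≤ 7`, with two distinct triangles, number at most
`C(n, 6) − C(n − 6, 6)`** (as `#{…} + C(n − 6, 6) ≤ C(n, 6)`): the counting half of the `(22, 7)` branch `s₃ ≥ 2`. -/
theorem ncard_indep_six_coindep_add_choose_le_of_two_triangles [M.Finite] {p d : ℕ}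
    (hn : M.E.ncard = p + d) {C₁ C₂ : Set α} (h1 : M.IsCircuit C₁) (h2 : M.IsCircuit C₂) (hne : C₁ ≠ C₂)
    (n1 : C₁.ncard = 3) (n2 : C₂.ncard = 3) (hd : d ≤ 7) :
    {B : Set α | B ⊆ M.E ∧ B.ncard = 6 ∧ M.eRk (M.E \ B) = (p : ℕ∞)}.ncard + (p + d - 6).choose 6 ≤
      (p + d).choose 6 := by
  classical
  have hEcard : M.ground_finite.toFinset.card = p + d := by
    rw [← Set.ncard_eq_toFinset_card _ M.ground_finite]; exact hn
  have hS : C₁ ∪ C₂ ⊆ (M.ground_finite.toFinset : Set α) := by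
    rw [Set.Finite.coe_toFinset]
    exact Set.union_subset h1.subset_ground h2.subset_ground
  have hs6 : (C₁ ∪ C₂).ncard ≤ 6 := by
    have := Set.ncard_union_le C₁ C₂
    omega
  have hsub := indep_six_coindep_subset_meeting (M := M) hn h1 h2 hne hd
  have hfin : {B : Set α | B ⊆ (M.ground_finite.toFinset : Set α) ∧ B.ncard = 6 ∧
      (B ∩ (C₁ ∪ C₂)).Nonempty}.Finite :=
    (M.ground_finite.toFinset.finite_toSet.finite_subsets).subset (fun B hB => hB.1)
  have hle := Set.ncard_le_ncard hsub hfin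
  have hcount := ncard_subsets_meeting_add_choose_le_of_ncard_le M.ground_finite.toFinset (C₁ ∪ C₂) hS 6 6 hs6
  rw [hEcard] at hcount
  omega

end Matroid

end PercRepro
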